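import Summits.BirchSwinnertonDyer.BirchSwinnertonDyer.Theorems.EisensteinPrimesFullDescentTheoremAPrimeLocal
import Summits.BirchSwinnertonDyer.BirchSwinnertonDyer.Theorems.EisensteinPrimesFullDescentOrdinaryAtPrime
import Summits.BirchSwinnertonDyer.BirchSwinnertonDyer.Theorems.EisensteinPrimesFullDescentOrdinaryDet
import Summits.BirchSwinnertonDyer.BirchSwinnertonDyer.Theorems.EisensteinPrimesFullDescentNoUnramifiedCharacter
import Literature.NumberTheory.EllipticCurves.OpenImageMazurCharacterProofs
import Literature.NumberTheory.EllipticCurves.PrimaryTorsionLocalGoodReductionFrobeniusProofs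
import HarnessLib

/-!
# Route `EisensteinPrimes`, crux 2 `GoodLatticeBDPValue` (stmt-BirchSwinnertonDyer-19032), line `halves`, road «R5 / AN-5»
# — brick A-II_p: **a rational cyclic group of order `p²` over the `ω`-line is impossible** (ANY odd prime `p`)

Cell `bsd-eis` (home `run/shared/lean/pub/bsd-eis/`), width seat `bsd-line-x1-p1-w3` (gen 13; `--supports -19032`, closes
nothing by itself). The `p`-version, token for token, of §1 and §3 of LEAD g5's `FullDescentTheoremAII` (`p = 3`, `N = 9`),
on width seat w7 (gen 7)'s road «R5 / AN-5» (T‴: a full-descent datum at `5 ≤ p` under the good-lattice normalisation;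
HOME STATUS 2026-08-28T21:34:45Z, brick table 21:47:17Z, interface 21:50:15Z). Given the output of A-I_p (w7's
`FullDescentTheoremAIPrime.exists_stable_sq_of_omega_point`: a `Γ_ℚ`-stable `B ≤ E[p²]` of order `p²` with
`B ∩ E[p] = ⟨Q⟩`, `Q` the `ω`-point) under the standing hypotheses (`p` odd, good ordinary; every `v ∤ p` good or split
multiplicative with `ℓ_v ≢ 1 (mod p)`):

* §1 `B = ⟨b⟩` is cyclic of order `p²` and carries a character `ψ_B : Γ_ℚ →* (ℤ/p²)ˣ` (`σ b = ψ_B(σ) b`) with open kernel;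
* §2 **`false_of_stable_sq`** (A3–A5): `ψ_B` agrees with `χ̄_{p²}` on every inertia group — at a split `v` by
  `FullDescentTheoremAPrime.smul_eq_chi_sq_smul_of_split` (TA-p-loc §3: `B = Ψ(μ_{p²})`), at a good `v ∤ p` by
  Néron–Ogg–Shafarevich, at `p` because `B = K₂` (uniqueness in `FullDescentOrdinaryNine.Rat.exists_kernel_of_omegaLine_atPrime`)
  on which inertia acts through `χ̄_{p²}` —, so `ψ_B = χ̄_{p²}` by (G-ℚ) (w2 gen 5's
  `monoidHom_eq_one_of_forall_greenbergInertia`); by the Weil pairing (w4 gen 6's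
  `smul_sub_mem_of_smul_eq_modNCyclotomicCharacter`) `Γ_ℚ` is then trivial on `E[p²]/B = E[p²]/K₂`, which the decomposition
  group at `p` forbids (`p² ≤ #Ẽ(𝔽_p) ≤ 2p + 1`).

HONEST FRAMING: helper theorems only (0 definitions, 0 named facts, 0 sorry); THEOREM A at `p` (= A-II_p ∘ A-I_p) is NOT
assembled here (A-I_p is w7's file); no summit statement, no BSD / IMC / Keller–Yin theorem, no stub of the registered
skeleton and no case of T‴ is proved by this file. References: [Kriz2016] Thm. 34; [SilvermanATAEC1994] V.3.1, Lemma V.5.2,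
Thm. V.5.3; [SilvermanAEC2009] III.8 (Weil pairing), VII.4.1; [Serre1972] §1.11; [NeukirchANT1999] III (2.17)–(2.18), II §9 (9.6).
-/

set_option autoImplicit false

-- the route's Theorems namespace repeats the summit name by design (D-0017 nested layout)
set_option linter.dupNamespace false

noncomputable section

open scoped Classical NumberField

namespace Summit.BirchSwinnertonDyer.BirchSwinnertonDyer.Theorems.FullDescentTheoremAPrime

open NumberField IsDedekindDomain Field WeierstrassCurve Rat.HeightOneSpectrum
  Literature.NumberTheory.EllipticCurves Literature.NumberTheory.GaloisRepresentations
  Summit.BirchSwinnertonDyer.BirchSwinnertonDyer.Theorems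

variable (W : WeierstrassCurve ℚ) [W.IsElliptic] {p : ℕ} [hp : Fact p.Prime]

/-! ## §1. `B` is cyclic of order `p²`; its character `ψ_B` -/

omit [W.IsElliptic] hp in
/-- Scalars on a point of order `n` are determined mod `n`. [folklore] -/
theorem zsmul_eq_zsmul_iff_of_addOrderOf_eq {b : geomPoints W} {n : ℕ} (hb : addOrderOf b = n) (m k : ℤ) :
    m • b = k • b ↔ (n : ℤ) ∣ m - k := by
  rw [← sub_eq_zero, ← sub_smul, ← addOrderOf_dvd_iff_zsmul_eq_zero, hb]

omit [W.IsElliptic] in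
/-- A unit of `ℤ/p²` is determined by its action on a point of order `p²`. [folklore] -/
theorem units_eq_of_val_smul_eq_sq {b : geomPoints W} (hb : addOrderOf b = p ^ 2) {u w : (ZMod (p ^ 2))ˣ}
    (h : ((u : ZMod (p ^ 2))).val • b = ((w : ZMod (p ^ 2))).val • b) : u = w := by
  rw [← natCast_zsmul, ← natCast_zsmul, zsmul_eq_zsmul_iff_of_addOrderOf_eq W hb] at h
  ext
  have h' : (((u : ZMod (p ^ 2)).val : ℤ) : ZMod (p ^ 2)) = (((w : ZMod (p ^ 2)).val : ℤ) : ZMod (p ^ 2)) :=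
    (ZMod.intCast_eq_intCast_iff_dvd_sub _ _ (p ^ 2)).mpr (by simpa using dvd_sub_comm.mp h)
  simpa using h'

omit [W.IsElliptic] in
/-- **`B` is cyclic of order `p²` with a character.** For a `Γ_ℚ`-stable `B ≤ E[p²]` of order `p²` whose `p`-torsion is the
line `⟨Q⟩` (`Q ≠ 0` in `E[p]`): `B = ⟨b⟩` with `b` of order `p²`, and `σ b = ψ(σ) b` for a homomorphism
`ψ : Γ_ℚ → (ℤ/p²)ˣ` whose kernel is the (open) stabiliser of `b`. [folklore] -/
theorem exists_generator_character {Q : geomTorsion W (p : ℤ)} (hQ0 : Q ≠ 0)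
    {B : AddSubgroup (geomPoints W)} (hB2 : B ≤ geomTorsion W ((p ^ 2 : ℕ) : ℤ)) (hcardB : Nat.card B = p ^ 2)
    (hBinf : B ⊓ geomTorsion W (p : ℤ) = AddSubgroup.zmultiples (Q : geomPoints W))
    (hBst : ∀ σ : absoluteGaloisGroup ℚ, ∀ x ∈ B, σ • x ∈ B) :
    ∃ b : geomPoints W, B = AddSubgroup.zmultiples b ∧ addOrderOf b = p ^ 2 ∧
      ∃ ψ : absoluteGaloisGroup ℚ →* (ZMod (p ^ 2))ˣ,
        (∀ σ : absoluteGaloisGroup ℚ, σ • b = ((ψ σ : (ZMod (p ^ 2))ˣ) : ZMod (p ^ 2)).val • b) ∧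
        IsOpen ((ψ.ker : Subgroup (absoluteGaloisGroup ℚ)) : Set (absoluteGaloisGroup ℚ)) := by
  have hpp : p.Prime := hp.out
  have hcC : Nat.card (AddSubgroup.zmultiples (Q : geomPoints W)) = p := by
    rw [Nat.card_zmultiples, AddSubgroup.addOrderOf_coe, addOrderOf_eq_of_ne_zero W p hQ0]
  have hCB : AddSubgroup.zmultiples (Q : geomPoints W) ≤ B := hBinf ▸ inf_le_left
  -- an element of `B` off `⟨Q⟩`, necessarily of order `p²`
  obtain ⟨b, hbB, hbC⟩ : ∃ b ∈ B, b ∉ AddSubgroup.zmultiples (Q : geomPoints W) := by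
    by_contra h
    push Not at h
    have hBC : B = AddSubgroup.zmultiples (Q : geomPoints W) := le_antisymm h hCB
    have hpp2 : p ^ 2 = p := by rw [← hcardB, hBC, hcC]
    have hlt : p < p ^ 2 := by simpa using Nat.pow_lt_pow_right hpp.one_lt (by norm_num : 1 < 2)
    omega
  have hb2 : ((p ^ 2 : ℕ) : ℤ) • b = 0 := mem_torsionBy_iff.mp (hB2 hbB)
  have hbp : ¬ (p : ℤ) • b = 0 := by
    intro h
    apply hbC
    rw [← hBinf]
    exact AddSubgroup.mem_inf.mpr ⟨hbB, mem_torsionBy_iff.mpr h⟩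
  have hordb : addOrderOf b = p ^ 2 := by
    have h2 : p ^ (1 + 1) • b = 0 := by
      rw [← natCast_zsmul]; simpa using hb2
    have h1 : ¬ p ^ 1 • b = 0 := by
      rw [pow_one, ← natCast_zsmul]; exact hbp
    simpa using addOrderOf_eq_prime_pow h1 h2
  have hBb : B = AddSubgroup.zmultiples b := by
    haveI : Finite B := Nat.finite_of_card_ne_zero (by rw [hcardB]; exact pow_ne_zero _ hpp.ne_zero)
    refine (AddSubgroup.eq_of_le_of_card_ge (AddSubgroup.zmultiples_le_of_mem hbB) ?_).symm
    rw [hcardB, Nat.card_zmultiples, hordb]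
  -- the exponent `e σ` with `σ b = e σ • b`
  have hex : ∀ σ : absoluteGaloisGroup ℚ, ∃ k : ℤ, σ • b = k • b := fun σ ↦ by
    have h := hBst σ b hbB
    rw [hBb] at h
    obtain ⟨k, hk⟩ := AddSubgroup.mem_zmultiples_iff.mp h
    exact ⟨k, hk.symm⟩
  choose e he using hex
  have hσz : ∀ (σ : absoluteGaloisGroup ℚ) (k : ℤ) (x : geomPoints W), σ • (k • x) = k • (σ • x) :=
    fun σ k x ↦ map_zsmul (DistribSMul.toAddMonoidHom _ σ) k x
  have hone : ((p ^ 2 : ℕ) : ℤ) ∣ e 1 - 1 := by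
    rw [← zsmul_eq_zsmul_iff_of_addOrderOf_eq W hordb, ← he 1, one_smul, one_smul]
  have hmul : ∀ σ τ, ((p ^ 2 : ℕ) : ℤ) ∣ e (σ * τ) - e σ * e τ := fun σ τ ↦ by
    rw [← zsmul_eq_zsmul_iff_of_addOrderOf_eq W hordb, ← he, mul_smul, he τ, hσz, he σ, smul_smul, mul_comm]
  -- the character into the multiplicative monoid `ℤ/p²`, then into its units
  let ψ₀ : absoluteGaloisGroup ℚ →* ZMod (p ^ 2) :=
    { toFun := fun σ ↦ ((e σ : ℤ) : ZMod (p ^ 2))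
      map_one' := by
        have h := (ZMod.intCast_eq_intCast_iff_dvd_sub (1 : ℤ) (e 1) (p ^ 2)).mpr hone
        rw [Int.cast_one] at h
        exact h.symm
      map_mul' := fun σ τ ↦ by
        have h := (ZMod.intCast_eq_intCast_iff_dvd_sub (e σ * e τ) (e (σ * τ)) (p ^ 2)).mpr (hmul σ τ)
        rw [Int.cast_mul] at h
        exact h.symm }
  have hψ₀ : ∀ σ, ψ₀ σ = ((e σ : ℤ) : ZMod (p ^ 2)) := fun _ ↦ rfl
  refine ⟨b, hBb, hordb, ψ₀.toHomUnits, fun σ ↦ ?_, ?_⟩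
  · rw [MonoidHom.coe_toHomUnits, hψ₀, he σ, ← natCast_zsmul, zsmul_eq_zsmul_iff_of_addOrderOf_eq W hordb,
      ZMod.val_intCast]
    exact (Int.mod_modEq _ _).dvd
  · -- the kernel is the stabiliser of `b`
    have hker : ((ψ₀.toHomUnits).ker : Set (absoluteGaloisGroup ℚ)) =
        MulAction.stabilizer (absoluteGaloisGroup ℚ) b := by
      ext σ
      simp only [SetLike.mem_coe, MonoidHom.mem_ker, MulAction.mem_stabilizer_iff]
      constructor
      · intro h
        have h' : ((ψ₀.toHomUnits σ : (ZMod (p ^ 2))ˣ) : ZMod (p ^ 2)) = 1 := by rw [h, Units.val_one]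
        rw [MonoidHom.coe_toHomUnits, hψ₀] at h'
        rw [he σ]
        have h2 : ((p ^ 2 : ℕ) : ℤ) ∣ e σ - 1 :=
          (ZMod.intCast_eq_intCast_iff_dvd_sub 1 (e σ) (p ^ 2)).mp (by rw [Int.cast_one]; exact h'.symm)
        rw [(zsmul_eq_zsmul_iff_of_addOrderOf_eq W hordb (e σ) 1).mpr h2, one_smul]
      · intro h
        ext
        rw [MonoidHom.coe_toHomUnits, hψ₀, Units.val_one]
        have h2 : ((p ^ 2 : ℕ) : ℤ) ∣ e σ - 1 := by
          rw [← zsmul_eq_zsmul_iff_of_addOrderOf_eq W hordb, ← he σ, one_smul, h]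
        have := (ZMod.intCast_eq_intCast_iff_dvd_sub 1 (e σ) (p ^ 2)).mpr h2
        rw [Int.cast_one] at this
        exact this.symm
    rw [hker]
    exact W.isOpen_stabilizer_point_holds b

/-! ## §2. Theorem A-II at `p` -/

/-- **Theorem A-II at an odd prime `p` (road R5 / AN-5, steps A3–A5): a rational cyclic group of order `p²` over the
`ω`-line is impossible.** `W/ℚ` globally minimal with good ORDINARY reduction at the odd prime `p`; every `v ∤ p` good or
split multiplicative with `ℓ_v ≢ 1 (mod p)`; `Q ≠ 0` the `ω`-point of `E[p]`; `B ≤ E[p²]` of order `p²`, `Γ_ℚ`-stable,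
`B ∩ E[p] = ⟨Q⟩`. Then `False`: the character `ψ_B` of the cyclic `B` (§1) agrees with `χ̄_{p²}` on every inertia group
(TA-p-loc §3 at split places, Néron–Ogg–Shafarevich at good places, `K₂ = B` at `p`), so `ψ_B = χ̄_{p²}` by (G-ℚ); by the
Weil pairing `Γ_ℚ` is then trivial on `E[p²]/B = E[p²]/K₂`, which the decomposition group at `p` forbids
(`p² ≤ #Ẽ(𝔽_p) ≤ 2p + 1`). [cite: Kriz2016, Thm. 34] [cite: Serre1972, §1.11 Prop. 11] [cite: NeukirchANT1999, Ch. III Thm. (2.17), Cor. (2.18)]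
[cite: SilvermanAEC2009, III.8 (Weil pairing)] -/
theorem false_of_stable_sq [W.IsGloballyMinimal] (hp2 : p ≠ 2)
    (hgood : W.HasGoodReductionAtPrime p) (hord : ¬ (p : ℤ) ∣ W.frobeniusTrace p)
    (hH : ∀ v : HeightOneSpectrum (𝓞 ℚ), natGenerator v ≠ p →
      W.HasGoodReductionAt v ∨ (W.HasSplitMultiplicativeReductionAt v ∧ ¬ natGenerator v ≡ 1 [MOD p]))
    {Q : geomTorsion W (p : ℤ)} (hQ0 : Q ≠ 0)
    (hQ : ∀ σ : absoluteGaloisGroup ℚ, σ • Q = ((modNCyclotomicCharacter ℚ p σ : (ZMod p)ˣ) : ZMod p).val • Q)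
    {B : AddSubgroup (geomPoints W)} (hB2 : B ≤ geomTorsion W ((p ^ 2 : ℕ) : ℤ)) (hcardB : Nat.card B = p ^ 2)
    (hBinf : B ⊓ geomTorsion W (p : ℤ) = AddSubgroup.zmultiples (Q : geomPoints W))
    (hBst : ∀ σ : absoluteGaloisGroup ℚ, ∀ x ∈ B, σ • x ∈ B) : False := by
  have hpp : p.Prime := hp.out
  have hp21 : p ^ 2 ≠ 1 := (Nat.one_lt_pow two_ne_zero hpp.one_lt).ne'
  -- §1: generator and character
  obtain ⟨b, hBb, hordb, ψ, hψ, hψker⟩ := exists_generator_character W hQ0 hB2 hcardB hBinf hBst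
  have hbB : b ∈ B := by rw [hBb]; exact AddSubgroup.mem_zmultiples b
  have hb2 : b ∈ geomTorsion W ((p ^ 2 : ℕ) : ℤ) := hB2 hbB
  -- the place above `p` and the kernel `K₂ = B`
  obtain ⟨vp, hvp'⟩ : ∃ vp : HeightOneSpectrum (𝓞 ℚ), primesEquiv vp = ⟨p, hpp⟩ :=
    ⟨(primesEquiv (R := 𝓞 ℚ)).symm ⟨p, hpp⟩, Equiv.apply_symm_apply _ _⟩
  have hvp : natGenerator vp = p := congrArg Subtype.val hvp'
  obtain ⟨K₂, -, -, -, -, -, -, -, hKχ, hKnot, hKuniq⟩ :=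
    FullDescentOrdinaryNine.Rat.exists_kernel_of_omegaLine_atPrime W p hp2 hgood hord hvp hQ0 (fun δ _ ↦ hQ δ)
  have hCmap : (AddSubgroup.zmultiples Q).map (geomTorsion W (p : ℤ)).subtype =
      AddSubgroup.zmultiples (Q : geomPoints W) := AddMonoidHom.map_zmultiples _ _
  have hBK : B = K₂ := hKuniq B hB2 hcardB (fun δ _ x hx ↦ hBst δ x hx) (by rw [hCmap]; exact hBinf)
  -- `φ = ψ χ̄_{p²}⁻¹` kills every inertia group
  -- (the type ascription on `χ̄_{p²}` lets the product elaborate before it is applied)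
  set χ₂ : absoluteGaloisGroup ℚ →* (ZMod (p ^ 2))ˣ := modNCyclotomicCharacter ℚ (p ^ 2) with hχ₂
  have hI : ∀ (v : HeightOneSpectrum (𝓞 ℚ)), ∀ τ ∈ GreenbergSelmer.inertia (K := ℚ) v,
      (ψ * χ₂⁻¹) τ = 1 := by
    intro v τ hτ
    rw [MonoidHom.mul_apply, MonoidHom.inv_apply, mul_inv_eq_one]
    apply units_eq_of_val_smul_eq_sq W hordb
    rw [← hψ τ]
    by_cases hv : natGenerator v = p
    · have hvv : v = vp :=
        (primesEquiv (R := 𝓞 ℚ)).injective (Subtype.ext (hv.trans hvp.symm))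
      rw [hvv] at hτ
      exact hKχ τ hτ b (hBK ▸ hbB)
    · obtain ⟨τ', hτ', rfl⟩ := Subgroup.mem_map.mp hτ
      rcases hH v hv with hgoodv | ⟨hsplit, hmod⟩
      · -- Néron–Ogg–Shafarevich on `E[p²]` and `χ̄_{p²}` unramified at `v`
        have hℓp : ¬ natGenerator v ∣ p := fun h ↦
          hv ((Nat.prime_dvd_prime_iff_eq (prime_natGenerator v) hpp).mp h)
        have hp2v : ¬ natGenerator v ∣ p ^ 2 := fun h ↦ hℓp ((prime_natGenerator v).dvd_of_dvd_pow h)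
        have hn : ((((p ^ 2 : ℕ) : ℤ)) : 𝓞 ℚ) ∉ v.asIdeal := by
          rw [Int.cast_natCast]
          exact fun h ↦ hp2v ((Rat.natCast_mem_asIdeal_iff v).mp h)
        have hp2v' : ((p ^ 2 : ℕ) : 𝓞 ℚ) ∉ v.asIdeal := fun h ↦ hp2v ((Rat.natCast_mem_asIdeal_iff v).mp h)
        have hfix := W.smul_eq_of_mem_absInertia_of_hasGoodReductionAt hgoodv hn hτ' (mem_torsionBy_iff.mp hb2)
        have hχ1 := Literature.NumberTheory.GaloisCohomology.modNCyclotomicCharacter_absGaloisRestrict_eq_one_of_mem_absInertia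
          ℚ (p ^ 2) v hp2v' hτ'
        rw [show (absGaloisRestrict ℚ (v.adicCompletion ℚ)).toMonoidHom τ' = absGaloisRestrict ℚ (v.adicCompletion ℚ) τ'
          from rfl, hfix, hχ1, Units.val_one, ZMod.val_one'' hp21, one_smul]
      · exact smul_eq_chi_sq_smul_of_split W hv hsplit hmod hQ0 hQ hB2 hcardB hBinf hBst τ' hbB
  have hker : IsOpen (((ψ * χ₂⁻¹).ker : Subgroup (absoluteGaloisGroup ℚ)) : Set (absoluteGaloisGroup ℚ)) := by
    apply Subgroup.isOpen_mono (H₁ := ψ.ker ⊓ χ₂.ker)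
    · intro σ hσ
      obtain ⟨h1, h2⟩ := Subgroup.mem_inf.mp hσ
      rw [MonoidHom.mem_ker] at h1 h2 ⊢
      rw [MonoidHom.mul_apply, MonoidHom.inv_apply, h1, h2, inv_one, mul_one]
    · rw [Subgroup.coe_inf, hχ₂]
      exact hψker.inter (Literature.NumberTheory.EllipticCurves.Mazur1978.isOpen_ker_modNCyclotomicCharacter (p ^ 2))
  have hφ := FullDescentNoUnramifiedCharacter.monoidHom_eq_one_of_forall_greenbergInertia _ hker hI
  -- so every `σ` acts on `b` through `χ̄_{p²}`
  have hψχ : ∀ σ : absoluteGaloisGroup ℚ,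
      σ • b = ((modNCyclotomicCharacter ℚ (p ^ 2) σ : (ZMod (p ^ 2))ˣ) : ZMod (p ^ 2)).val • b := by
    intro σ
    have h := congrArg (fun f : absoluteGaloisGroup ℚ →* (ZMod (p ^ 2))ˣ ↦ f σ) hφ
    simp only [MonoidHom.mul_apply, MonoidHom.inv_apply, MonoidHom.one_apply, mul_inv_eq_one] at h
    rw [hψ σ, h, hχ₂]
  -- Weil: `Γ_ℚ` is trivial on `E[p²]/B`
  have htriv : ∀ (σ : absoluteGaloisGroup ℚ), ∀ y ∈ geomTorsion W ((p ^ 2 : ℕ) : ℤ),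
      σ • y - y ∈ AddSubgroup.zmultiples b := fun σ ↦
    FullDescentOrdinaryNine.smul_sub_mem_zmultiples_of_smul_eq_modNCyclotomicCharacter W (p ^ 2)
      (hpp.two_le.trans (Nat.le_self_pow two_ne_zero p)) hb2 hordb σ (hψχ σ)
  -- contradiction at `p`
  exact hKnot fun δ _ x hx ↦ by rw [← hBK, hBb]; exact htriv δ x hx

end Summit.BirchSwinnertonDyer.BirchSwinnertonDyer.Theorems.FullDescentTheoremAPrime

end
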